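import Mathlib
import Summits.NavierStokesRegularity.NavierStokesRegularity.Theorems.EulerZoomLiouvillePowerGaugeEulerLiouvilleCondenserCirculation

/-!
# The fluctuation tax: the WHOLE swirl on a circle costs enstrophy and radial velocity (t44-W, nsreg-p2 g33 plate; SEEDS-R44 (R44-2))

Planar kinematics on top of t43-S (`…CondenserCirculation`: `dir`, `dirPerp`, `dirBar`, (S1)–(S4)).  For a `C¹` field `v : ℂ → ℂ`,
on the circle of radius `ρ` write `v_r(θ) = Re(v(ρd) d̄)`, `v_θ(θ) = Im(v(ρd) d̄)`.  Then

* (W1) `hasDerivAt_swirlComponent` — `d/dθ v_θ = Im(Dv(ρd)[ρd⊥] d̄) − v_r` (a strain entry minus the radial velocity);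
* (W2) `sq_sub_le_two_pi_mul_integral_sq` — oscillation: `(g(θ) − g(θ₀))² ≤ 2π∫_{−π}^{π} g′²` for `θ, θ₀ ∈ [−π,π]`;
* (W3) `exists_two_pi_mul_eq_integral` — a continuous `g` takes its mean value on `[−π,π]`;
* (W4) `integral_sq_le_of_hasDerivAt` — WEAK WIRTINGER: `∫g² ≤ 8π²∫g′² + (∫g)²/π` (sharp constant `1` not needed);
* (W5) `integral_sq_swirl_le` — THE TAX: `∫_{−π}^{π} v_θ² ≤ (16π²+2)ρ²∫_{−π}^{π}‖Dv(ρd)‖² + 16π²∫_{−π}^{π} v_r²` (`0 ≤ ρ`).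

Reading (SEEDS-R44 (R44-2), ROUND-43 §3 gap G3): t43-S taxed only the MEAN swirl (circulation); (W5) taxes all of it, modulo the
radial component — so a cyclostrophically held pressure drop `∫ mean(v_θ²) dlog ρ` across a thin layer costs angular Dirichlet energy
unless the layer carries radial flow.  WHAT THIS IS NOT: not NS, not E = 19832 (OPEN); 2-D calculus; [folklore].
-/

noncomputable section

open Set MeasureTheory intervalIntegral Complex Real

set_option linter.dupNamespace false

namespace Summit.NavierStokesRegularity.NavierStokesRegularity.Theorems.PowerGaugeEulerLiouville.Condenser

variable {v : ℂ → ℂ}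

/-- **(W1) Derivative of the SWIRL component along a circle.**
`∂_θ Im(v(ρd(θ)) d̄(θ)) = Im(Dv(ρd)[ρd⊥] d̄) − Re(v(ρd) d̄)` (since `∂_θ d̄ = −i d̄`): the angular derivative of the swirl is a
strain entry minus the radial velocity. [folklore] -/
theorem hasDerivAt_swirlComponent (hv : Differentiable ℝ v) (ρ θ : ℝ) :
    HasDerivAt (fun θ : ℝ => (v ((ρ : ℂ) * dir θ) * dirBar θ).im)
      ((fderiv ℝ v ((ρ : ℂ) * dir θ) ((ρ : ℂ) * dirPerp θ) * dirBar θ).im -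
        (v ((ρ : ℂ) * dir θ) * dirBar θ).re) θ := by
  have hvθ : HasDerivAt (fun θ : ℝ => v ((ρ : ℂ) * dir θ)) (fderiv ℝ v ((ρ : ℂ) * dir θ) ((ρ : ℂ) * dirPerp θ)) θ :=
    (hv _).hasFDerivAt.comp_hasDerivAt θ (hasDerivAt_circle ρ θ)
  have hprod := hvθ.mul (hasDerivAt_dirBar θ)
  have him := (Complex.imCLM.hasFDerivAt.comp_hasDerivAt θ hprod)
  have e : Complex.imCLM (fderiv ℝ v ((ρ : ℂ) * dir θ) ((ρ : ℂ) * dirPerp θ) * dirBar θ +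
      v ((ρ : ℂ) * dir θ) * ((-(Real.sin θ) : ℂ) - (Real.cos θ : ℂ) * I)) =
      (fderiv ℝ v ((ρ : ℂ) * dir θ) ((ρ : ℂ) * dirPerp θ) * dirBar θ).im -
        (v ((ρ : ℂ) * dir θ) * dirBar θ).re := by
    simp only [Complex.imCLM_apply, add_im, dirBar, mul_re, mul_im, sub_re, sub_im, ofReal_re, ofReal_im, neg_re,
      neg_im, I_re, I_im, mul_zero, mul_one, sub_zero, zero_sub, mul_neg]
    ring
  rw [← e]
  exact him

/-- **(W2) Oscillation is controlled by the Dirichlet energy on the circle**: for `θ₀, θ ∈ [−π, π]`,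
`(g(θ) − g(θ₀))² ≤ 2π ∫_{−π}^{π} g′²` (fundamental theorem + Cauchy–Schwarz). [folklore] -/
theorem sq_sub_le_two_pi_mul_integral_sq {g g' : ℝ → ℝ} (hg : ∀ θ, HasDerivAt g (g' θ) θ) (hg' : Continuous g')
    {θ₀ θ : ℝ} (hθ₀ : θ₀ ∈ Icc (-π) π) (hθ : θ ∈ Icc (-π) π) :
    (g θ - g θ₀) ^ 2 ≤ 2 * π * ∫ t in (-π)..π, (g' t) ^ 2 := by
  have hint : ∀ a b : ℝ, IntervalIntegrable g' volume a b := fun a b => hg'.intervalIntegrable _ _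
  have hftc : ∀ a b : ℝ, ∫ t in a..b, g' t = g b - g a := fun a b =>
    integral_eq_sub_of_hasDerivAt (fun t _ => hg t) (hint a b)
  have habsi : IntervalIntegrable (fun t => |g' t|) volume (-π) π := hg'.abs.intervalIntegrable _ _
  have hnn : 0 ≤ᵐ[volume.restrict (Ioc (-π) π)] fun t => |g' t| := ae_of_all _ fun t => abs_nonneg _
  -- `|g θ − g θ₀| ≤ ∫_{−π}^{π} |g'|`
  have key : |g θ - g θ₀| ≤ ∫ t in (-π)..π, |g' t| := by
    rcases le_total θ₀ θ with h | h
    · rw [← hftc θ₀ θ]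
      calc |∫ t in θ₀..θ, g' t| ≤ ∫ t in θ₀..θ, |g' t| := abs_integral_le_integral_abs h
        _ ≤ ∫ t in (-π)..π, |g' t| := integral_mono_interval hθ₀.1 h hθ.2 hnn habsi
    · rw [abs_sub_comm, ← hftc θ θ₀]
      calc |∫ t in θ..θ₀, g' t| ≤ ∫ t in θ..θ₀, |g' t| := abs_integral_le_integral_abs h
        _ ≤ ∫ t in (-π)..π, |g' t| := integral_mono_interval hθ.1 h hθ₀.2 hnn habsi
  have hcs := sq_integral_le_two_pi_mul_integral_sq (f := fun t => |g' t|) hg'.abs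
  have habs : ∫ t in (-π)..π, |g' t| ^ 2 = ∫ t in (-π)..π, (g' t) ^ 2 := by
    congr 1
    funext t
    exact sq_abs _
  calc (g θ - g θ₀) ^ 2 = |g θ - g θ₀| ^ 2 := (sq_abs _).symm
    _ ≤ (∫ t in (-π)..π, |g' t|) ^ 2 := pow_le_pow_left₀ (abs_nonneg _) key 2
    _ ≤ 2 * π * ∫ t in (-π)..π, |g' t| ^ 2 := hcs
    _ = 2 * π * ∫ t in (-π)..π, (g' t) ^ 2 := by rw [habs]

/-- **(W3) A continuous function takes its mean value on `[−π, π]`**: `∃ θ₀ ∈ [−π,π], 2π·g(θ₀) = ∫_{−π}^{π} g`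
(extreme values + intermediate value theorem). [folklore] -/
theorem exists_two_pi_mul_eq_integral {g : ℝ → ℝ} (hg : Continuous g) :
    ∃ θ₀ ∈ Icc (-π) π, 2 * π * g θ₀ = ∫ t in (-π)..π, g t := by
  have hπ : -π ≤ π := by linarith [Real.pi_pos]
  have h2π : 0 < 2 * π := by linarith [Real.pi_pos]
  have hne : (Icc (-π) π).Nonempty := nonempty_Icc.2 hπ
  obtain ⟨a, ha, hmin⟩ := isCompact_Icc.exists_isMinOn hne hg.continuousOn
  obtain ⟨b, hb, hmax⟩ := isCompact_Icc.exists_isMaxOn hne hg.continuousOn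
  have hci : ∀ c : ℝ, IntervalIntegrable (fun _ : ℝ => c) volume (-π) π := fun c =>
    continuous_const.intervalIntegrable _ _
  have h1 : 2 * π * g a ≤ ∫ t in (-π)..π, g t := by
    have h := intervalIntegral.integral_mono_on hπ (hci (g a)) (hg.intervalIntegrable _ _) fun t ht => hmin ht
    rw [intervalIntegral.integral_const, smul_eq_mul] at h
    linarith
  have h2 : ∫ t in (-π)..π, g t ≤ 2 * π * g b := by
    have h := intervalIntegral.integral_mono_on hπ (hg.intervalIntegrable _ _) (hci (g b)) fun t ht => hmax ht
    rw [intervalIntegral.integral_const, smul_eq_mul] at h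
    linarith
  have hsub : uIcc a b ⊆ Icc (-π) π := uIcc_subset_Icc ha hb
  have hab : g a ≤ g b := hmin hb
  have hmem : (∫ t in (-π)..π, g t) / (2 * π) ∈ uIcc (g a) (g b) := by
    rw [uIcc_of_le hab]
    exact ⟨(le_div_iff₀ h2π).2 (by linarith), (div_le_iff₀ h2π).2 (by linarith)⟩
  obtain ⟨θ₀, hθ₀, hval⟩ := intermediate_value_uIcc (hg.continuousOn) hmem
  refine ⟨θ₀, hsub hθ₀, ?_⟩
  rw [hval]
  field_simp

/-- **(W4) WEAK WIRTINGER (variance–mean split) on the circle**: `∫_{−π}^{π} g² ≤ 8π² ∫_{−π}^{π} g′² + (∫_{−π}^{π} g)²/π`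
(the sharp constant in front of `∫g′²` would be `1` for the mean-free part; `8π²` suffices for orders of magnitude). [folklore] -/
theorem integral_sq_le_of_hasDerivAt {g g' : ℝ → ℝ} (hg : ∀ θ, HasDerivAt g (g' θ) θ) (hg' : Continuous g') :
    ∫ t in (-π)..π, (g t) ^ 2 ≤
      8 * π ^ 2 * (∫ t in (-π)..π, (g' t) ^ 2) + (∫ t in (-π)..π, g t) ^ 2 / π := by
  have hgc : Continuous g := continuous_iff_continuousAt.2 fun θ => (hg θ).continuousAt
  have hπ : -π ≤ π := by linarith [Real.pi_pos]
  have hπ0 : 0 < π := Real.pi_pos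
  obtain ⟨θ₀, hθ₀, hmean⟩ := exists_two_pi_mul_eq_integral hgc
  set E := ∫ t in (-π)..π, (g' t) ^ 2 with hE
  set M := ∫ t in (-π)..π, g t with hM
  have hpt : ∀ t ∈ Icc (-π) π, (g t) ^ 2 ≤ 4 * π * E + 2 * (g θ₀) ^ 2 := by
    intro t ht
    have h := sq_sub_le_two_pi_mul_integral_sq hg hg' hθ₀ ht
    nlinarith [sq_nonneg (g t - 2 * g θ₀)]
  have ig : IntervalIntegrable (fun t => (g t) ^ 2) volume (-π) π := (hgc.pow 2).intervalIntegrable _ _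
  have ic : IntervalIntegrable (fun _ : ℝ => 4 * π * E + 2 * (g θ₀) ^ 2) volume (-π) π :=
    continuous_const.intervalIntegrable _ _
  have hint := intervalIntegral.integral_mono_on hπ ig ic hpt
  rw [intervalIntegral.integral_const, smul_eq_mul] at hint
  have hMe : 4 * π * (g θ₀) ^ 2 = M ^ 2 / π := by
    rw [← hmean]
    field_simp
    ring
  calc ∫ t in (-π)..π, (g t) ^ 2 ≤ (π - -π) * (4 * π * E + 2 * (g θ₀) ^ 2) := hint
    _ = 8 * π ^ 2 * E + 4 * π * (g θ₀) ^ 2 := by ring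
    _ = 8 * π ^ 2 * E + M ^ 2 / π := by rw [hMe]

/-- **(W5) THE FLUCTUATION TAX per circle.**  For `0 ≤ ρ`:
`∫_{−π}^{π} v_θ² dθ ≤ (16π² + 2) ρ² ∫_{−π}^{π} ‖Dv(ρd)‖² dθ + 16π² ∫_{−π}^{π} v_r² dθ`,
`v_θ = Im(v(ρd) d̄)`, `v_r = Re(v(ρd) d̄)`: the WHOLE swirl (not only its circulation part, t43-S (S3)) is paid for by the angular
Dirichlet energy and the radial component ((W4) for `g = v_θ`, (W1) for `g′`, and (S3) for the mean).  Text use (SEEDS-R44 (R44-2)): a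
cyclostrophically held pressure drop across a thin layer costs enstrophy. [folklore] -/
theorem integral_sq_swirl_le (hv : ContDiff ℝ 1 v) {ρ : ℝ} (hρ : 0 ≤ ρ) :
    ∫ θ in (-π)..π, ((v ((ρ : ℂ) * dir θ) * dirBar θ).im) ^ 2 ≤
      (16 * π ^ 2 + 2) * ρ ^ 2 * (∫ θ in (-π)..π, ‖fderiv ℝ v ((ρ : ℂ) * dir θ)‖ ^ 2) +
        16 * π ^ 2 * ∫ θ in (-π)..π, ((v ((ρ : ℂ) * dir θ) * dirBar θ).re) ^ 2 := by
  have hvd : Differentiable ℝ v := hv.differentiable one_ne_zero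
  have hdc : Continuous dir := by unfold dir; fun_prop
  have hdpc : Continuous dirPerp := by unfold dirPerp; fun_prop
  have hdbc : Continuous dirBar := by unfold dirBar; fun_prop
  have hcirc : Continuous fun θ : ℝ => (ρ : ℂ) * dir θ := continuous_const.mul hdc
  have hDc : Continuous fun θ : ℝ => fderiv ℝ v ((ρ : ℂ) * dir θ) := (hv.continuous_fderiv one_ne_zero).comp hcirc
  have hNc : Continuous fun θ : ℝ => ‖fderiv ℝ v ((ρ : ℂ) * dir θ)‖ := hDc.norm
  have hvc : Continuous fun θ : ℝ => v ((ρ : ℂ) * dir θ) * dirBar θ := (hvd.continuous.comp hcirc).mul hdbc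
  have hRc : Continuous fun θ : ℝ => (v ((ρ : ℂ) * dir θ) * dirBar θ).re := Complex.continuous_re.comp hvc
  have hAc : Continuous fun θ : ℝ => (fderiv ℝ v ((ρ : ℂ) * dir θ) ((ρ : ℂ) * dirPerp θ) * dirBar θ).im :=
    Complex.continuous_im.comp ((hDc.clm_apply (continuous_const.mul hdpc)).mul hdbc)
  set g : ℝ → ℝ := fun θ => (v ((ρ : ℂ) * dir θ) * dirBar θ).im with hg_def
  set g' : ℝ → ℝ := fun θ => (fderiv ℝ v ((ρ : ℂ) * dir θ) ((ρ : ℂ) * dirPerp θ) * dirBar θ).im -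
    (v ((ρ : ℂ) * dir θ) * dirBar θ).re with hg'_def
  have hg : ∀ θ, HasDerivAt g (g' θ) θ := fun θ => hasDerivAt_swirlComponent hvd ρ θ
  have hg' : Continuous g' := hAc.sub hRc
  have hW := integral_sq_le_of_hasDerivAt hg hg'
  -- pointwise: `g'² ≤ 2ρ²‖Dv‖² + 2 v_r²`
  have hpt : ∀ θ ∈ Icc (-π) π, (g' θ) ^ 2 ≤
      2 * ρ ^ 2 * ‖fderiv ℝ v ((ρ : ℂ) * dir θ)‖ ^ 2 + 2 * ((v ((ρ : ℂ) * dir θ) * dirBar θ).re) ^ 2 := by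
    intro θ _
    have ha : |(fderiv ℝ v ((ρ : ℂ) * dir θ) ((ρ : ℂ) * dirPerp θ) * dirBar θ).im| ≤
        ρ * ‖fderiv ℝ v ((ρ : ℂ) * dir θ)‖ := by
      calc |(fderiv ℝ v ((ρ : ℂ) * dir θ) ((ρ : ℂ) * dirPerp θ) * dirBar θ).im|
          ≤ ‖fderiv ℝ v ((ρ : ℂ) * dir θ) ((ρ : ℂ) * dirPerp θ) * dirBar θ‖ := Complex.abs_im_le_norm _
        _ = ‖fderiv ℝ v ((ρ : ℂ) * dir θ) ((ρ : ℂ) * dirPerp θ)‖ := by rw [norm_mul, norm_dirBar, mul_one]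
        _ ≤ ‖fderiv ℝ v ((ρ : ℂ) * dir θ)‖ * ‖(ρ : ℂ) * dirPerp θ‖ := ContinuousLinearMap.le_opNorm _ _
        _ = ρ * ‖fderiv ℝ v ((ρ : ℂ) * dir θ)‖ := by
            rw [norm_mul, norm_dirPerp, mul_one, Complex.norm_real, Real.norm_eq_abs, abs_of_nonneg hρ, mul_comm]
    have ha2 : ((fderiv ℝ v ((ρ : ℂ) * dir θ) ((ρ : ℂ) * dirPerp θ) * dirBar θ).im) ^ 2 ≤
        (ρ * ‖fderiv ℝ v ((ρ : ℂ) * dir θ)‖) ^ 2 := by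
      rw [← sq_abs]
      exact pow_le_pow_left₀ (abs_nonneg _) ha 2
    have hsplit : (g' θ) ^ 2 ≤ 2 * ((fderiv ℝ v ((ρ : ℂ) * dir θ) ((ρ : ℂ) * dirPerp θ) * dirBar θ).im) ^ 2 +
        2 * ((v ((ρ : ℂ) * dir θ) * dirBar θ).re) ^ 2 := by
      rw [hg'_def]
      nlinarith [sq_nonneg ((fderiv ℝ v ((ρ : ℂ) * dir θ) ((ρ : ℂ) * dirPerp θ) * dirBar θ).im +
        (v ((ρ : ℂ) * dir θ) * dirBar θ).re)]
    nlinarith [ha2]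
  have hπ : -π ≤ π := by linarith [Real.pi_pos]
  have iD : IntervalIntegrable (fun θ => 2 * ρ ^ 2 * ‖fderiv ℝ v ((ρ : ℂ) * dir θ)‖ ^ 2) volume (-π) π :=
    (continuous_const.mul (hNc.pow 2)).intervalIntegrable _ _
  have iR : IntervalIntegrable (fun θ => 2 * ((v ((ρ : ℂ) * dir θ) * dirBar θ).re) ^ 2) volume (-π) π :=
    (continuous_const.mul (hRc.pow 2)).intervalIntegrable _ _
  have ig : IntervalIntegrable (fun θ => (g' θ) ^ 2) volume (-π) π := (hg'.pow 2).intervalIntegrable _ _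
  have hE' : ∫ θ in (-π)..π, (g' θ) ^ 2 ≤
      2 * ρ ^ 2 * (∫ θ in (-π)..π, ‖fderiv ℝ v ((ρ : ℂ) * dir θ)‖ ^ 2) +
        2 * ∫ θ in (-π)..π, ((v ((ρ : ℂ) * dir θ) * dirBar θ).re) ^ 2 := by
    have h := intervalIntegral.integral_mono_on hπ ig (iD.add iR) hpt
    rw [intervalIntegral.integral_add iD iR, intervalIntegral.integral_const_mul,
      intervalIntegral.integral_const_mul] at h
    exact h
  have hS3 := sq_integral_swirl_le hv hρ
  have hD0 : 0 ≤ ∫ θ in (-π)..π, ‖fderiv ℝ v ((ρ : ℂ) * dir θ)‖ ^ 2 :=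
    integral_nonneg hπ fun θ _ => sq_nonneg _
  have hπ0 : 0 < π := Real.pi_pos
  have hmean : (∫ θ in (-π)..π, g θ) ^ 2 / π ≤ 2 * ρ ^ 2 * ∫ θ in (-π)..π, ‖fderiv ℝ v ((ρ : ℂ) * dir θ)‖ ^ 2 := by
    rw [div_le_iff₀ hπ0]
    calc (∫ θ in (-π)..π, g θ) ^ 2 ≤ 2 * π * ρ ^ 2 * ∫ θ in (-π)..π, ‖fderiv ℝ v ((ρ : ℂ) * dir θ)‖ ^ 2 := hS3
      _ = 2 * ρ ^ 2 * (∫ θ in (-π)..π, ‖fderiv ℝ v ((ρ : ℂ) * dir θ)‖ ^ 2) * π := by ring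
  have hπ2 : 0 ≤ 8 * π ^ 2 := by positivity
  calc ∫ θ in (-π)..π, (g θ) ^ 2
      ≤ 8 * π ^ 2 * (∫ θ in (-π)..π, (g' θ) ^ 2) + (∫ θ in (-π)..π, g θ) ^ 2 / π := hW
    _ ≤ 8 * π ^ 2 * (2 * ρ ^ 2 * (∫ θ in (-π)..π, ‖fderiv ℝ v ((ρ : ℂ) * dir θ)‖ ^ 2) +
          2 * ∫ θ in (-π)..π, ((v ((ρ : ℂ) * dir θ) * dirBar θ).re) ^ 2) +
        2 * ρ ^ 2 * ∫ θ in (-π)..π, ‖fderiv ℝ v ((ρ : ℂ) * dir θ)‖ ^ 2 :=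
        add_le_add (mul_le_mul_of_nonneg_left hE' hπ2) hmean
    _ = (16 * π ^ 2 + 2) * ρ ^ 2 * (∫ θ in (-π)..π, ‖fderiv ℝ v ((ρ : ℂ) * dir θ)‖ ^ 2) +
        16 * π ^ 2 * ∫ θ in (-π)..π, ((v ((ρ : ℂ) * dir θ) * dirBar θ).re) ^ 2 := by ring

end Summit.NavierStokesRegularity.NavierStokesRegularity.Theorems.PowerGaugeEulerLiouville.Condenser

end
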